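import Literature.Algebra.Homology.DiscreteRepCoindPullbackNormal
import Literature.Algebra.Homology.DiscreteRepCoresRes
import Literature.Algebra.Homology.ExtAdjunctionCanonical
import Literature.Algebra.Homology.ExtMapExactFunctorNaturality
import Literature.Algebra.Homology.DiscreteRepEnoughInjectives
import HarnessLib

/-!
# The Mackey isomorphism and Shapiro's lemma: the local components of a class on `Coind_U^Γ(W)`
# pulled back along `φ : H → Γ` are the pull-backs along the CONJUGATED maps `V → U`, `v ↦ s φ(v) s⁻¹`

Topic `Algebra/Homology`; namespace `Literature.Algebra.Homology.DiscreteRep`.  Definitions with bodies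
(`conjHom`, `conjNatTrans`, `trivSingle`) and theorems; no named fact, no instance, no notation, no `sorry`.
Sequel of `DiscreteRepCoindPullbackNormal` (bsd-eis -w4 g20: the Mackey isomorphism
`M : Res_φ Coind_U^Γ(W) ≅ Coind_V^H(W^T)`, `V = φ⁻¹U`, `T = U\Γ/φ(H)`, `(M f) h t = f (s_t φ h)`), door-c4's
`DiscreteRepOpenSubgroup` / `DiscreteRepCoresRes` (`coindResAdj : Coind ⊣ Res`), `ExtAdjunctionCanonical`
(the canonical Shapiro map `Sh(x) = [η] ∘ Res(x)`, bijective) and `ExtMapExactFunctorNaturality`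
(`Ext.mapExactFunctor` along composites and natural transformations).

THE STATEMENT.  Let `Γ ⊇ U` (open, normal, finite index), `φ : H →* Γ` continuous, `V = φ⁻¹(U)`,
`B ∈ C_Γ`, `Y ∈ C_H`, `q : Res_φ B ⟶ Y`, `W` a `k`-module, `P = Coind_U^Γ(triv W)`.  For a class
`x ∈ Extⁿ_{C_Γ}(P, B)` consider its LOCALISATION `q_* Res_φ(x) ∈ Extⁿ_{C_H}(Res_φ P, Y)`, transport it along
`M` to `Extⁿ_{C_H}(Coind_V^H(triv W^T), Y)`, apply Shapiro for `(H, V)` and take the `t`-th component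
(`t ∈ T`, pre-composition with `ι_t : triv W → triv W^T`).  The result is

  `Res_{ψ_t}(Sh_{Γ,U}(x)) ∘ [q ∘ ρ_B(s_t⁻¹)] ∈ Extⁿ_{C_V}(triv W, Res_V Y)`     (`locComponent_eq`)

where `Sh_{Γ,U}(x) = [η] ∘ Res_U(x) ∈ Extⁿ_{C_U}(triv W, Res_U B)` is the Shapiro class of `x` and
`ψ_t : V →* U`, `v ↦ s_t φ(v) s_t⁻¹` (`s_t` the chosen representative of `t`).  Ingredients: (i) the unit
of `Coind ⊣ Res` is `w ↦ 1_U · w` (`coindResAdj_unit_apply_coe`, from Mathlib's `indToCoindAux`); (ii)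
`ρ(s⁻¹)` is a natural transformation `Res_U ⋙ Res_{ψ_s} ⟶ Res_φ ⋙ Res_V` (`conjNatTrans`), so
`[ρ_P(s⁻¹)] ∘ Res_V Res_φ(x) = Res_ψ Res_U(x) ∘ [ρ_B(s⁻¹)]` (`ExtFunctoriality.mapExactFunctor_natTrans`);
(iii) `ι_t ≫ η' ≫ Res_V(M⁻¹) = Res_ψ(η) ≫ ρ_P(s_t⁻¹)` on vectors: both are `w ↦ 1_{U s_t} · w`
(`trivSingle_unit_mackeyInv`).

USE (lane «PT-Ш-S-TC», crux `stmt-BirchSwinnertonDyer-19032`, brick (Λ)(e), file E2b of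
`LAMBDA-E-DEVISSAGE-w4g20.md`): with `Γ = G_S`, `H = Γ_{K_v}`, `B = Ī_S`, `Y = K̄_vˣ`, the `(v, t)`-component
of `ExtLocalization.locMap` on a permutation module `Coind_U(ℤ^m)` is the pull-back of the Shapiro class in
`Hʳ(U, Ī_S)` along the decomposition map of the place `w_t ∣ v` of `E = K_S^U` followed by the idèle
projection at `w_t` — the shape in which the arithmetic inputs `[P0]`–`[P2]` of the dévissage are stated.
HONEST FRAMING: homological bookkeeping; no arithmetic statement and nothing about BSD is proved here.
AI formalisation, established only by the kernel check.

## References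
* K. S. Brown, *Cohomology of Groups*, GTM 87 (1982), III §5 Prop. 5.6 (b), III §6 (Shapiro) and
  Ex. III.8.2 (compatibility of Shapiro with restriction). [Brown1982CohomologyGroups]
* D. Harari, *Galois Cohomology and Class Field Theory*, Universitext (2020), Prop. 1.39, Remark 16.13,
  §17.5 Lemma 17.23. [Harari2020]
* C. A. Weibel, *An introduction to homological algebra* (1994), Lemma 6.3.2. [Weibel1994]
-/

noncomputable section

universe u

namespace Literature.Algebra.Homology

namespace DiscreteRep

open CategoryTheory CategoryTheory.Limits CategoryTheory.Abelian

/-! ## §1 The unit of `Coind ⊣ Res` on vectors: `w ↦ 1_U · w` -/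

section Unit

variable {k Γ : Type u} [CommRing k] [Group Γ] [TopologicalSpace Γ] [IsTopologicalGroup Γ]
  (U : Subgroup Γ) (hU : IsOpen (U : Set Γ)) [U.FiniteIndex]

/-- Mathlib's `indToCoindAux` at the identity coset, inside `S`: `(⟦1 ⊗ a⟧ : Ind) ↦ (g ↦ ρ(g) a)` for `g ∈ S`.
[cite: Harari2020, §1.2 Prop. 1.15] -/
theorem Rep.indToCoindAux_one_apply_of_mem {G : Type u} [Group G] (S : Subgroup G)
    [DecidableRel (QuotientGroup.rightRel S)] (A : Rep.{u} k S) (a : A.V) {g : G} (hg : g ∈ S) :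
    Rep.indToCoindAux A 1 a g = A.ρ ⟨g, hg⟩ a := by
  have h : (QuotientGroup.rightRel S) g 1 := by
    rw [QuotientGroup.rightRel_apply]; simpa using S.inv_mem hg
  rw [Rep.indToCoindAux, LinearMap.pi_apply, dif_pos h]
  congr 2
  exact Subtype.ext (by simp)

/-- Mathlib's `indToCoindAux` at the identity coset, outside `S`: the value is `0`.
[cite: Harari2020, §1.2 Prop. 1.15] -/
theorem Rep.indToCoindAux_one_apply_of_not_mem {G : Type u} [Group G] (S : Subgroup G)
    [DecidableRel (QuotientGroup.rightRel S)] (A : Rep.{u} k S) (a : A.V) {g : G} (hg : g ∉ S) :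
    Rep.indToCoindAux A 1 a g = 0 := by
  have h : ¬ (QuotientGroup.rightRel S) g 1 := by
    rw [QuotientGroup.rightRel_apply]; simpa using fun h => hg (by simpa using S.inv_mem h)
  exact Rep.indToCoindAux_of_not_rel 1 g a h

/-- The unit of Mathlib's `Rep.coindResAdjunction` on vectors is `indToCoindAux` at the identity coset.
[cite: Harari2020, §1.2 Prop. 1.15] -/
theorem Rep.coindResAdjunction_unit_apply_coe {G : Type u} [Group G] (S : Subgroup G) [S.FiniteIndex]
    [DecidableRel (QuotientGroup.rightRel S)] (A : Rep.{u} k S) (a : A.V) :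
    (((Rep.coindResAdjunction k S).unit.app A).hom a).1 = Rep.indToCoindAux A 1 a := by
  rw [Rep.coindResAdjunction_unit_app]
  erw [Adjunction.mkOfHomEquiv_unit_app]
  change ((Rep.indCoindIso A).hom.hom ((Rep.indResHomEquiv S.subtype A _ (𝟙 _)).hom a)).1 = _
  simp [Rep.indResHomEquiv, Rep.indCoindIso, Rep.indToCoind, Representation.IndV.mk]

/-- Under `ι : C_U ⥤ Rep k U` the unit of `coindResAdj` is Mathlib's unit of `Rep.coindResAdjunction`
(for the classical decidability instance used in `coindResAdj`). [cite: Harari2020, §4.3 (1)] -/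
theorem ι_map_coindResAdj_unit_app (N : DiscreteRepCat k U) :
    letI : DecidableRel (QuotientGroup.rightRel U) := Classical.decRel _
    (ι k U).map ((coindResAdj U hU).unit.app N) = (Rep.coindResAdjunction k U).unit.app N.obj := by
  letI : DecidableRel (QuotientGroup.rightRel U) := Classical.decRel _
  refine (Adjunction.map_restrictFullyFaithful_unit_app (Rep.coindResAdjunction k U)
    (iC := ι k U) (iD := ι k Γ) (L := coindD k U hU) (R := resD k U)
    (isDiscrete k U).fullyFaithfulι (isDiscrete k Γ).fullyFaithfulι (Iso.refl _) (Iso.refl _) N).trans ?_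
  erw [CategoryTheory.Functor.map_id, Category.comp_id]
  rfl

/-- The unit of `coindResAdj` on vectors is Mathlib's `indToCoindAux` at the identity coset.
[cite: Harari2020, §1.2 Prop. 1.15, §4.3 (1)] -/
theorem coindResAdj_unit_apply_coe (N : DiscreteRepCat k U) (n : N.obj.V) :
    letI : DecidableRel (QuotientGroup.rightRel U) := Classical.decRel _
    (((coindResAdj U hU).unit.app N).hom.hom n).1 = Rep.indToCoindAux N.obj 1 n := by
  letI : DecidableRel (QuotientGroup.rightRel U) := Classical.decRel _
  have h := Rep.coindResAdjunction_unit_apply_coe U N.obj n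
  rw [← ι_map_coindResAdj_unit_app U hU N] at h
  exact h

/-- **The unit `η_N : N → Res_U Coind_U^Γ N` on vectors**: `(η n)(g) = ρ(g) n` for `g ∈ U` (the function
supported on the identity coset). [cite: Harari2020, §1.2 Prop. 1.15, §4.3 (1)] -/
theorem coindResAdj_unit_apply_coe_of_mem (N : DiscreteRepCat k U) (n : N.obj.V) {g : Γ} (hg : g ∈ U) :
    (((coindResAdj U hU).unit.app N).hom.hom n).1 g = N.obj.ρ ⟨g, hg⟩ n := by
  letI : DecidableRel (QuotientGroup.rightRel U) := Classical.decRel _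
  rw [coindResAdj_unit_apply_coe U hU N n]
  exact Rep.indToCoindAux_one_apply_of_mem U N.obj n hg

/-- The unit vanishes off `U`. [cite: Harari2020, §1.2 Prop. 1.15, §4.3 (1)] -/
theorem coindResAdj_unit_apply_coe_of_not_mem (N : DiscreteRepCat k U) (n : N.obj.V) {g : Γ}
    (hg : g ∉ U) : (((coindResAdj U hU).unit.app N).hom.hom n).1 g = 0 := by
  letI : DecidableRel (QuotientGroup.rightRel U) := Classical.decRel _
  rw [coindResAdj_unit_apply_coe U hU N n]
  exact Rep.indToCoindAux_one_apply_of_not_mem U N.obj n hg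

end Unit

/-! ## §2 Conjugation: `ρ(s⁻¹) : Res_U ⋙ Res_{ψ_s} ⟶ Res_φ ⋙ Res_V`, `ψ_s(v) = s φ(v) s⁻¹` -/

section Conj

variable {k Γ H : Type u} [CommRing k] [Group Γ] [TopologicalSpace Γ] [IsTopologicalGroup Γ]
  [Group H] [TopologicalSpace H] [IsTopologicalGroup H]
  (φ : H →* Γ) (hφ : Continuous φ) (U : Subgroup Γ) [hUn : U.Normal]

/-- The conjugated map `ψ_s : φ⁻¹(U) →* U`, `v ↦ s φ(v) s⁻¹` (lands in `U` by normality).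
[cite: Brown1982CohomologyGroups, III §5 Prop. 5.6 (b)] -/
def conjHom (s : Γ) : ↥(U.comap φ) →* ↥U where
  toFun v := ⟨s * φ (v : H) * s⁻¹, hUn.conj_mem _ v.2 s⟩
  map_one' := Subtype.ext (by simp)
  map_mul' v w := Subtype.ext (by
    change s * φ ((v : H) * w) * s⁻¹ = s * φ (v : H) * s⁻¹ * (s * φ (w : H) * s⁻¹)
    rw [map_mul]; group)

omit [TopologicalSpace Γ] [IsTopologicalGroup Γ] [TopologicalSpace H] [IsTopologicalGroup H] in
/-- Formula. [cite: Brown1982CohomologyGroups, III §5 Prop. 5.6 (b)] -/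
@[simp]
theorem coe_conjHom_apply (s : Γ) (v : ↥(U.comap φ)) : ((conjHom φ U s v : U) : Γ) = s * φ (v : H) * s⁻¹ :=
  rfl

omit [IsTopologicalGroup H] in
include hφ in
/-- `ψ_s` is continuous. [cite: Brown1982CohomologyGroups, III §5 Prop. 5.6 (b)] -/
theorem continuous_conjHom (s : Γ) : Continuous (conjHom φ U s) := by
  refine continuous_induced_rng.2 ?_
  change Continuous fun v : ↥(U.comap φ) => s * φ (v : H) * s⁻¹
  exact ((continuous_const.mul (hφ.comp continuous_subtype_val)).mul continuous_const)

/-- **`ρ(s⁻¹)` as a natural transformation `Res_U ⋙ Res_{ψ_s} ⟶ Res_φ ⋙ Res_V`** of exact functors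
`C_Γ ⥤ C_V` (`V = φ⁻¹U`): on `X ∈ C_Γ` it is `ρ_X(s⁻¹)`, `V`-equivariant because
`ρ(s⁻¹) ρ(s φ(v) s⁻¹) = ρ(φ v) ρ(s⁻¹)`. [cite: Brown1982CohomologyGroups, III §8 (conjugation action), III §5 Prop. 5.6 (b)] -/
def conjNatTrans (s : Γ) :
    resD k U ⋙ resDHom k (conjHom φ U s) (continuous_conjHom φ hφ U s) ⟶
      resDHom k φ hφ ⋙ resD k (U.comap φ) where
  app X := ObjectProperty.homMk (Rep.ofHom
    { toLinearMap := X.obj.ρ s⁻¹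
      isIntertwining' := fun v => LinearMap.ext fun x => by
        change X.obj.ρ s⁻¹ (X.obj.ρ (s * φ (v : H) * s⁻¹) x) = X.obj.ρ (φ (v : H)) (X.obj.ρ s⁻¹ x)
        rw [← Module.End.mul_apply, ← map_mul, ← Module.End.mul_apply, ← map_mul]
        congr 2; group })
  naturality X X' f := by
    apply ObjectProperty.hom_ext
    apply Rep.hom_ext
    apply DFunLike.ext
    intro x
    change X'.obj.ρ s⁻¹ (f.hom.hom x) = f.hom.hom (X.obj.ρ s⁻¹ x)
    exact (Rep.hom_comm_apply f.hom s⁻¹ x).symm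

omit [IsTopologicalGroup H] in
/-- Formula: `conjNatTrans s` acts on vectors by `ρ_X(s⁻¹)`. [cite: Brown1982CohomologyGroups, III §8] -/
@[simp]
theorem conjNatTrans_app_hom_hom_apply (s : Γ) (X : DiscreteRepCat k Γ) (x : X.obj.V) :
    ((conjNatTrans φ hφ U s).app X).hom.hom x = X.obj.ρ s⁻¹ x := rfl

end Conj

/-! ## §3 The `t`-th unit vector and the key identity on vectors -/

section Component

open scoped Classical

variable {k Γ H : Type u} [CommRing k] [Group Γ] [TopologicalSpace Γ] [IsTopologicalGroup Γ]
  [Group H] [TopologicalSpace H] [IsTopologicalGroup H]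
  (φ : H →* Γ) (hφ : Continuous φ) (U : Subgroup Γ) [hUn : U.Normal] (hU : IsOpen (U : Set Γ))
  [U.FiniteIndex] [hVf : (U.comap φ).FiniteIndex]
  (W : Type u) [AddCommGroup W] [Module k W]

/-- The `t`-th coordinate inclusion `ι_t : triv W ⟶ triv (T → W)` in `C_V`, `w ↦ Pi.single t w`.
[cite: Brown1982CohomologyGroups, III §5 (5.6)] -/
def trivSingle (t : DoubleCosets φ U) :
    triv (k := k) (Γ := ↥(U.comap φ)) W ⟶ triv (k := k) (Γ := ↥(U.comap φ)) (DoubleCosets φ U → W) :=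
  ObjectProperty.homMk (Rep.ofHom
    { toLinearMap := LinearMap.single k (fun _ : DoubleCosets φ U => W) t
      isIntertwining' := fun _ => LinearMap.ext fun _ => rfl })

omit [TopologicalSpace Γ] [IsTopologicalGroup Γ] [IsTopologicalGroup H] hUn [U.FiniteIndex] hVf in
/-- Formula. [cite: Brown1982CohomologyGroups, III §5 (5.6)] -/
@[simp]
theorem trivSingle_hom_hom_apply (t : DoubleCosets φ U) (w : W) :
    (trivSingle φ U W t (k := k)).hom.hom w = Pi.single t w := rfl

/-- **Key identity on vectors**: `ι_t ≫ η' ≫ Res_V(M⁻¹) = Res_ψ(η) ≫ ρ_P(s_t⁻¹)` as morphisms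
`triv W ⟶ Res_V Res_φ Coind_U^Γ(W)` in `C_V` — both send `w` to the function `1_{U s_t} · w` on `Γ`.
[cite: Brown1982CohomologyGroups, III §5 Prop. 5.6 (b), Ex. III.8.2] -/
theorem trivSingle_unit_mackeyInv (t : DoubleCosets φ U) :
    trivSingle φ U W t (k := k) ≫
      (coindResAdj (U.comap φ) (isOpen_comap φ U hφ hU)).unit.app
        (triv (k := k) (Γ := ↥(U.comap φ)) (DoubleCosets φ U → W)) ≫
      (resD k (U.comap φ)).map (coindPullbackIso φ hφ U hU W (k := k)).inv =
    (resDHom k (conjHom φ U (dcRep φ U t)) (continuous_conjHom φ hφ U (dcRep φ U t))).map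
        ((coindResAdj U hU).unit.app (triv (k := k) (Γ := ↥U) W)) ≫
      (conjNatTrans φ hφ U (dcRep φ U t) (k := k)).app
        ((coindD k U hU).obj (triv (k := k) (Γ := ↥U) W)) := by
  apply ObjectProperty.hom_ext
  apply Rep.hom_ext
  apply DFunLike.ext
  intro w
  apply Subtype.ext
  funext x
  obtain ⟨u, h, hx⟩ := exists_decomp φ U x
  -- the left-hand side at `x = u · s(t') · φ h`, `t' = [x]`
  have lhs : ((trivSingle φ U W t (k := k) ≫
      (coindResAdj (U.comap φ) (isOpen_comap φ U hφ hU)).unit.app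
        (triv (k := k) (Γ := ↥(U.comap φ)) (DoubleCosets φ U → W)) ≫
      (resD k (U.comap φ)).map (coindPullbackIso φ hφ U hU W (k := k)).inv).hom.hom w).1 x =
      (if h ∈ U.comap φ then (Pi.single t w : DoubleCosets φ U → W) (dcMk φ U x) else 0) := by
    change ((coindPullbackIso φ hφ U hU W (k := k)).inv.hom.hom
      (((coindResAdj (U.comap φ) (isOpen_comap φ U hφ hU)).unit.app
        (triv (k := k) (Γ := ↥(U.comap φ)) (DoubleCosets φ U → W))).hom.hom (Pi.single t w))).1 x = _
    conv_lhs => rw [hx]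
    rw [coindPullbackIso_inv_apply]
    by_cases hh : h ∈ U.comap φ
    · rw [coindResAdj_unit_apply_coe_of_mem _ _ _ _ hh, if_pos hh]
      rfl
    · rw [coindResAdj_unit_apply_coe_of_not_mem _ _ _ _ hh, if_neg hh]
      rfl
  -- the right-hand side at `x`: `(η w)(x s_t⁻¹)`
  have rhs : (((resDHom k (conjHom φ U (dcRep φ U t)) (continuous_conjHom φ hφ U (dcRep φ U t))).map
        ((coindResAdj U hU).unit.app (triv (k := k) (Γ := ↥U) W)) ≫
      (conjNatTrans φ hφ U (dcRep φ U t) (k := k)).app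
        ((coindD k U hU).obj (triv (k := k) (Γ := ↥U) W))).hom.hom w).1 x =
      (if x * (dcRep φ U t)⁻¹ ∈ U then w else 0) := by
    change ((((coindD k U hU).obj (triv (k := k) (Γ := ↥U) W)).obj.ρ (dcRep φ U t)⁻¹)
      (((coindResAdj U hU).unit.app (triv (k := k) (Γ := ↥U) W)).hom.hom w)).1 x = _
    change (((coindResAdj U hU).unit.app (triv (k := k) (Γ := ↥U) W)).hom.hom w).1 (x * (dcRep φ U t)⁻¹) = _
    by_cases hm : x * (dcRep φ U t)⁻¹ ∈ U
    · rw [coindResAdj_unit_apply_coe_of_mem _ _ _ _ hm, if_pos hm]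
      rfl
    · rw [coindResAdj_unit_apply_coe_of_not_mem _ _ _ _ hm, if_neg hm]
      rfl
  refine lhs.trans (Eq.trans ?_ rhs.symm)
  -- compare the two indicator conditions
  have key : (h ∈ U.comap φ ∧ dcMk φ U x = t) ↔ x * (dcRep φ U t)⁻¹ ∈ U := by
    constructor
    · rintro ⟨hh, ht⟩
      rw [hx, ht]
      have h1 : ((u : Γ) * dcRep φ U t * φ h) * (dcRep φ U t)⁻¹ =
          (u : Γ) * (dcRep φ U t * φ h * (dcRep φ U t)⁻¹) := by group
      rw [h1]
      exact U.mul_mem u.2 (hUn.conj_mem _ hh _)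
    · intro hm
      -- `x = m · s_t` with `m ∈ U`, so `[x] = t` …
      have hxm : x = ((⟨_, hm⟩ : U) : Γ) * dcRep φ U t := by simp
      have ht : dcMk φ U x = t := by rw [hxm, dcMk_mul_left, dcMk_dcRep]
      refine ⟨?_, ht⟩
      -- … and `u · s_t · φ h = x = m · s_t`, so `φ h = s_t⁻¹ (u⁻¹ m) s_t ∈ U`
      rw [ht] at hx
      have e : φ h = (dcRep φ U t)⁻¹ * ((u : Γ)⁻¹ * (x * (dcRep φ U t)⁻¹)) * (dcRep φ U t) := by
        conv_rhs => rw [hx]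
        group
      rw [Subgroup.mem_comap, e]
      have := hUn.conj_mem _ (U.mul_mem (U.inv_mem u.2) hm) (dcRep φ U t)⁻¹
      simpa using this
  by_cases hm : x * (dcRep φ U t)⁻¹ ∈ U
  · obtain ⟨hh, ht⟩ := key.2 hm
    rw [if_pos hh, if_pos hm, ht, Pi.single_eq_same]
  · rw [if_neg hm]
    by_cases hh : h ∈ U.comap φ
    · rw [if_pos hh]
      have ht : dcMk φ U x ≠ t := fun ht => hm (key.1 ⟨hh, ht⟩)
      rw [Pi.single_eq_of_ne ht]
    · rw [if_neg hh]

end Component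


/-! ## §4 The local components of a class on `Coind_U^Γ(W)` -/

section Main

open scoped Classical

variable {k Γ H : Type u} [CommRing k] [Group Γ] [TopologicalSpace Γ] [IsTopologicalGroup Γ]
  [Group H] [TopologicalSpace H] [IsTopologicalGroup H]
  (φ : H →* Γ) (hφ : Continuous φ) (U : Subgroup Γ) [hUn : U.Normal] (hU : IsOpen (U : Set Γ))
  [U.FiniteIndex] [hVf : (U.comap φ).FiniteIndex]
  (W : Type u) [AddCommGroup W] [Module k W]
  (B : DiscreteRepCat k Γ) (Y : DiscreteRepCat k H) (q : (resDHom k φ hφ).obj B ⟶ Y) (n : ℕ)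

/-- The conjugated coefficient map `q_s := ρ_B(s⁻¹) ≫ Res_V(q) : Res_{ψ_s} Res_U B ⟶ Res_V Y` in `C_V`
(`b ↦ q (ρ_B(s⁻¹) b)`). [cite: Brown1982CohomologyGroups, III §8, III §5 Prop. 5.6 (b)] -/
def conjCoeff (s : Γ) :
    (resDHom k (conjHom φ U s) (continuous_conjHom φ hφ U s)).obj ((resD k U).obj B) ⟶
      (resD k (U.comap φ)).obj Y :=
  (conjNatTrans φ hφ U s (k := k)).app B ≫ (resD k (U.comap φ)).map q

omit [IsTopologicalGroup H] [U.FiniteIndex] hVf in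
/-- Formula. [cite: Brown1982CohomologyGroups, III §8] -/
@[simp]
theorem conjCoeff_hom_hom_apply (s : Γ) (b : B.obj.V) :
    (conjCoeff φ hφ U B Y q s (k := k)).hom.hom b = q.hom.hom (B.obj.ρ s⁻¹ b) := rfl

/-- **The `t`-th local component** of a class `x ∈ Extⁿ_{C_Γ}(Coind_U^Γ(triv W), B)`: localise
(`q_* ∘ Res_φ`), transport along the Mackey isomorphism, apply Shapiro for `(H, φ⁻¹U)` and pre-compose
with the `t`-th coordinate `ι_t`. [cite: Harari2020, §17.5 Lemma 17.23][cite: Brown1982CohomologyGroups, III §5 Prop. 5.6 (b)] -/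
def locComponent (t : DoubleCosets φ U)
    (x : Ext ((coindD k U hU).obj (triv (k := k) (Γ := ↥U) W)) B n) :
    Ext (triv (k := k) (Γ := ↥(U.comap φ)) W) ((resD k (U.comap φ)).obj Y) n :=
  (Ext.mk₀ (trivSingle φ U W t (k := k))).comp
    (ExtAdjunction.extAdjunctionMap (coindResAdj (U.comap φ) (isOpen_comap φ U hφ hU))
      (triv (k := k) (Γ := ↥(U.comap φ)) (DoubleCosets φ U → W)) Y n
      ((Ext.mk₀ (coindPullbackIso φ hφ U hU W (k := k)).inv).comp
        ((x.mapExactFunctor (resDHom k φ hφ)).comp (Ext.mk₀ q) (add_zero n)) (zero_add n)))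
    (zero_add n)

/-- **The local components are conjugated pull-backs of the Shapiro class**: for
`x ∈ Extⁿ_{C_Γ}(Coind_U^Γ(triv W), B)` and `t ∈ U\Γ/φ(H)` with representative `s = s_t`,
`locComponent t x = Res_{ψ_s}(Sh_{Γ,U}(x)) ∘ [q ∘ ρ_B(s⁻¹)]`, where
`Sh_{Γ,U}(x) = [η] ∘ Res_U(x) ∈ Extⁿ_{C_U}(triv W, Res_U B)` is the canonical Shapiro class and
`ψ_s : φ⁻¹U → U`, `v ↦ s φ(v) s⁻¹`. [cite: Brown1982CohomologyGroups, III §5 Prop. 5.6 (b), Ex. III.8.2]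
[cite: Harari2020, §17.5 Lemma 17.23, Remark 16.13] -/
theorem locComponent_eq (t : DoubleCosets φ U)
    (x : Ext ((coindD k U hU).obj (triv (k := k) (Γ := ↥U) W)) B n) :
    locComponent φ hφ U hU W B Y q n t x =
      ((ExtAdjunction.extAdjunctionMap (coindResAdj U hU) (triv (k := k) (Γ := ↥U) W) B n x).mapExactFunctor
          (resDHom k (conjHom φ U (dcRep φ U t)) (continuous_conjHom φ hφ U (dcRep φ U t)))).comp
        (Ext.mk₀ (conjCoeff φ hφ U B Y q (dcRep φ U t) (k := k))) (add_zero n) := by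
  -- exactness of the two composite functors `C_Γ ⥤ C_V`
  haveI : PreservesFiniteLimits (resDHom k φ hφ ⋙ resD k (U.comap φ)) := comp_preservesFiniteLimits _ _
  haveI : PreservesFiniteColimits (resDHom k φ hφ ⋙ resD k (U.comap φ)) := comp_preservesFiniteColimits _ _
  haveI : PreservesFiniteLimits
      (resD k U ⋙ resDHom k (conjHom φ U (dcRep φ U t)) (continuous_conjHom φ hφ U (dcRep φ U t))) :=
    comp_preservesFiniteLimits _ _
  haveI : PreservesFiniteColimits
      (resD k U ⋙ resDHom k (conjHom φ U (dcRep φ U t)) (continuous_conjHom φ hφ U (dcRep φ U t))) :=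
    comp_preservesFiniteColimits _ _
  unfold locComponent conjCoeff
  rw [ExtAdjunction.extAdjunctionMap_apply, ExtAdjunction.extAdjunctionMap_apply]
  simp only [ExtAdjunction.unitHom, Adjunction.homEquiv_id, Ext.mapExactFunctor_comp,
    Ext.mapExactFunctor_mk₀]
  -- collapse the three leading morphisms on the left and use the key identity on vectors
  rw [Ext.mk₀_comp_mk₀_assoc, Ext.mk₀_comp_mk₀_assoc, Category.assoc]
  erw [trivSingle_unit_mackeyInv φ hφ U hU W t]
  erw [← Ext.mk₀_comp_mk₀_assoc]
  -- fold the iterated functors into composites and use naturality of `ρ(s⁻¹)`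
  rw [← ExtFunctoriality.mapExactFunctor_comp_functor (resDHom k φ hφ) (resD k (U.comap φ)) x,
    ← ExtFunctoriality.mapExactFunctor_comp_functor (resD k U)
      (resDHom k (conjHom φ U (dcRep φ U t)) (continuous_conjHom φ hφ U (dcRep φ U t))),
    ← Ext.comp_assoc_of_third_deg_zero]
  erw [ExtFunctoriality.mapExactFunctor_natTrans (conjNatTrans φ hφ U (dcRep φ U t) (k := k)) x]
  -- reassociate (`erw` with explicit arguments: the goal carries `(𝟭 _).obj`-typed subterms)
  erw [Ext.comp_assoc_of_third_deg_zero
      (Ext.mapExactFunctor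
        (resD k U ⋙ resDHom k (conjHom φ U (dcRep φ U t)) (continuous_conjHom φ hφ U (dcRep φ U t))) x)
      (Ext.mk₀ ((conjNatTrans φ hφ U (dcRep φ U t) (k := k)).app B))
      (Ext.mk₀ ((resD k (U.comap φ)).map q)) (add_zero n)]
  erw [Ext.mk₀_comp_mk₀ ((conjNatTrans φ hφ U (dcRep φ U t) (k := k)).app B)
      ((resD k (U.comap φ)).map q)]
  exact (Ext.comp_assoc_of_third_deg_zero _ _ _ (zero_add n)).symm

end Main

end DiscreteRep

end Literature.Algebra.Homology

end
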